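import Mathlib
import HarnessLib
import Summits.FinalStateConjecture.FinalStateConjecture.Theses.StarvedNecks
import Literature.Geometry.Lorentzian.BackgroundChartCalculusFramed
import Summits.FinalStateConjecture.FinalStateConjecture.Theorems.BartnikGapSettlingGapExhaustionKerrRadiusSublevelConvex

/-!
# Sketch (crux-ideate, ideator 2): crux `FutureOrientedOfSeamed` (stmt-FinalStateConjecture-17576)
# idea `clock-duality-rays`

Evidence only.  Contents:

* `SlabOrientationFromAnchor` — the chart-local transfer C⁺ (one smooth chart from a boosted
  sub-extremal Kerr exterior into ANY spacetime; `C⁰` convergence on every truncated slab; ONE anchor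
  sphere `{r = R₀}`, `R₀ ≥ 100 M`, on which `dΨ(Λe₀)` is future-directed at all late times) ⇒ clause (ii)
  of `IsFutureOriented` for that chart.
* `futureOrientedOfSeamed_of_slabOrientationFromAnchor` — C⁺ ⇒ the crux, sorry-free (uses Hc (a), Hc (d),
  Sm (1), Sm (5) and the structure's own fixed-radius convergence; nothing else).
* `anchorHandshake` — the first lemma of the line, PROVED: at one point, a future-directed pushed vector
  `dΨ u` hands its orientation to `dΨ w` as soon as the whole segment `(1−θ)u + θw` stays
  `g_B + δ‖·‖²`-negative (convexity of timecones + the affine map `θ ↦ g(T, dΨ v_θ)` has no zero).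
* `RadiusRayMonotone` — the only geometric input of the propagation step (signature): the Kerr–Schild
  radius is monotone along spatial rays from the origin (star-shapedness of the solid confocal
  ellipsoids, cf. `kerrSublevel_radius_le_iff`).
-/

noncomputable section

open scoped Manifold ContDiff ENNReal Topology
open Filter Topology Set Function

universe u

namespace Summit.FinalStateConjecture.FinalStateConjecture.Cruxes.FutureOrientedOfSeamed.ClockDualityRays

open Literature.Geometry.Lorentzian

set_option linter.dupNamespace false
-- instance search through nested operator types `E4 →L E4 →L ℝ`
set_option maxSynthPendingDepth 3

/-- **C⁺ (chart-local transfer).** For ONE smooth chart `Ψ` from the boosted sub-extremal Kerr exterior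
`(M, a, Λ, c)` into ANY spacetime: `C⁰` convergence to the boosted background on every truncated slab,
plus future-directedness of `dΨ(Λe₀)` on the anchor sphere `{r = R₀}` (`100 M ≤ R₀`) at all chart times
`≥ T`, force clause (ii) of `IsFutureOriented`: for every `ρ`, eventually in `τ`, `dΨ(Λ V_{M,a} ∘ Λ⁻¹(· − c))`
is future-directed on the truncated slab `{t* = τ, r ≤ ρ}`. -/
def SlabOrientationFromAnchor : Prop :=
  ∀ (𝓢 : Spacetime.{0} 4) (M a : ℝ) (Λ : lorentzGroup) (c : E4)
    (Ψ : (boostedKerrBackground Λ c M a).domain → 𝓢.carrier) (R₀ T : ℝ),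
    0 < M → Kerr.IsSubextremal M a → 100 * M ≤ R₀ →
    ContMDiff 𝓘(ℝ, E4) (𝓡 4) ∞ Ψ →
    (∀ ρ : ℝ, Tendsto (fun τ ↦ 𝓢.truncDeviationCk (boostedKerrBackground Λ c M a) Ψ 0 ρ τ)
      atTop (𝓝 0)) →
    (∀ x : (boostedKerrBackground Λ c M a).domain,
      T ≤ (boostedKerrBackground Λ c M a).time x.1 →
      (boostedKerrBackground Λ c M a).radius x.1 = R₀ →
      𝓢.timeOrientation.IsFutureDirected
        (mfderiv 𝓘(ℝ, E4) (𝓡 4) Ψ x ((Λ : E4 ≃L[ℝ] E4) (E4.basisVector 0)))) →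
    ∀ ρ : ℝ, ∀ᶠ τ in atTop, ∀ x ∈ (boostedKerrBackground Λ c M a).truncTimeSlab ρ τ,
      𝓢.timeOrientation.IsFutureDirected
        (mfderiv 𝓘(ℝ, E4) (𝓡 4) Ψ x
          ((Λ : E4 ≃L[ℝ] E4) (Kerr.timeVector M a (poincareInv Λ c (x : E4)))))

/-- **Ray monotonicity of the Kerr–Schild radius** (signature; the geometric input of the propagation
step): along a spatial ray from the origin at fixed `t*`, `r` is non-decreasing — the solid confocal
ellipsoids `{r ≤ c}` are star-shaped about the origin (`kerrSublevel_radius_le_iff`: they are the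
sublevel sets `c²(x₁² + x₂²) + (c² + a²)x₃² ≤ c²(c² + a²)` of a quadratic form). -/
def RadiusRayMonotone : Prop :=
  ∀ (a τ : ℝ) (v : E3) (s s' : ℝ), 0 ≤ s → s ≤ s' →
    Kerr.radius a (E4.ofTimeSpace τ (s • v)) ≤ Kerr.radius a (E4.ofTimeSpace τ (s' • v))

/-- **Clock duality** (signature of the one-line algebraic identity the anchor step uses): the boosted
background pairs the transported Kerr time vector `W = Λ V(Λ⁻¹(x − c))` with ANY coordinate vector `u`
to minus the chart-clock rate of `u`: `g_B(x)(W, u) = −(Λ⁻¹u)⁰ = −dt*_{Λ,c}(u)` (`Kerr.bilin_timeVector`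
transported by `Λ`). In particular `g_B(W, Λe₀) = −1` and `g_B(W, W) = −1 − 2H`. -/
def ClockDuality : Prop :=
  ∀ (M a : ℝ) (Λ : lorentzGroup) (c x u : E4), 0 < Kerr.radius a (poincareInv Λ c x) →
    boostedKerrBilin Λ c M a x ((Λ : E4 ≃L[ℝ] E4) (Kerr.timeVector M a (poincareInv Λ c x))) u =
      -(((Λ : E4 ≃L[ℝ] E4).symm u) 0)

/-- Clock duality holds (two rewrites). [folklore] -/
theorem clockDuality : ClockDuality := by
  intro M a Λ c x u hx
  rw [boostedKerrBilin_apply, ContinuousLinearEquiv.symm_apply_apply, Kerr.bilin_timeVector hx]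

/-- **First lemma of the line — the anchor handshake (PROVED).** At a point `x` of a chart `Ψ` on a model
background `B`, if the deviation `(Ψ^*g − g_B)(x)` has operator norm `≤ δ`, the straight segment of
coordinate vectors `v_θ = (1 − θ)u + θw`, `θ ∈ [0, 1]`, satisfies `g_B(v_θ, v_θ) + δ‖v_θ‖² < 0`, and `dΨ u`
is future-directed, then `dΨ w` is future-directed: every `dΨ v_θ` is timelike, so the AFFINE function
`θ ↦ g(T, dΨ v_θ)` has no zero on `[0, 1]` (a timelike vector is never orthogonal to the orienting field),
and it is negative at `θ = 0`. O'Neill 1983, Ch. 5, Lemma 5.26 ff. [folklore] -/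
theorem anchorHandshake (𝓢 : Spacetime.{u} 4) (B : ModelBackground) (Ψ : B.domain → 𝓢.carrier)
    (x : B.domain) (u w : E4) {δ : ℝ} (hdev : ‖𝓢.deviation B Ψ x‖ ≤ δ)
    (hneg : ∀ θ ∈ Icc (0 : ℝ) 1,
      B.bilin x.1 ((1 - θ) • u + θ • w) ((1 - θ) • u + θ • w) +
        δ * ‖(1 - θ) • u + θ • w‖ ^ 2 < 0)
    (hu : 𝓢.timeOrientation.IsFutureDirected (mfderiv 𝓘(ℝ, E4) (𝓡 4) Ψ x u)) :
    𝓢.timeOrientation.IsFutureDirected (mfderiv 𝓘(ℝ, E4) (𝓡 4) Ψ x w) := by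
  set L : E4 →L[ℝ] TangentSpace (𝓡 4) (Ψ x) := mfderiv 𝓘(ℝ, E4) (𝓡 4) Ψ x with hL
  -- every pushed segment vector is timelike
  have htl : ∀ θ ∈ Icc (0 : ℝ) 1,
      𝓢.metric.val (Ψ x) (L ((1 - θ) • u + θ • w)) (L ((1 - θ) • u + θ • w)) < 0 := by
    intro θ hθ
    set v : E4 := (1 - θ) • u + θ • w with hv
    have happ : 𝓢.deviation B Ψ x v v =
        𝓢.metric.val (Ψ x) (L v) (L v) - B.bilin x.1 v v := 𝓢.deviation_apply B Ψ x v v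
    have hle : 𝓢.deviation B Ψ x v v ≤ δ * ‖v‖ ^ 2 :=
      calc 𝓢.deviation B Ψ x v v ≤ ‖𝓢.deviation B Ψ x v v‖ := Real.le_norm_self _
        _ ≤ ‖𝓢.deviation B Ψ x‖ * ‖v‖ * ‖v‖ := ContinuousLinearMap.le_opNorm₂ _ _ _
        _ ≤ δ * ‖v‖ * ‖v‖ := by gcongr
        _ = δ * ‖v‖ ^ 2 := by ring
    have h := hneg θ hθ
    rw [happ] at hle
    linarith
  -- the affine test function
  have hlin : ∀ θ : ℝ,
      𝓢.metric.val (Ψ x) (𝓢.timeOrientation.vectorField (Ψ x)) (L ((1 - θ) • u + θ • w)) =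
        (1 - θ) * 𝓢.metric.val (Ψ x) (𝓢.timeOrientation.vectorField (Ψ x)) (L u) +
          θ * 𝓢.metric.val (Ψ x) (𝓢.timeOrientation.vectorField (Ψ x)) (L w) := by
    intro θ
    simp only [map_add, map_smul, smul_eq_mul]
  have htl' : ∀ θ ∈ Icc (0 : ℝ) 1, 𝓢.metric.IsTimelike (L ((1 - θ) • u + θ • w)) :=
    fun θ hθ ↦ htl θ hθ
  have hne : ∀ θ ∈ Icc (0 : ℝ) 1,
      𝓢.metric.val (Ψ x) (𝓢.timeOrientation.vectorField (Ψ x)) (L ((1 - θ) • u + θ • w)) ≠ 0 :=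
    fun θ hθ ↦ 𝓢.metric.val_ne_zero_of_isTimelike_of_isCausal (𝓢.timeOrientation.isTimelike (Ψ x))
      (htl' θ hθ).isCausal
  have h0 : 𝓢.metric.val (Ψ x) (𝓢.timeOrientation.vectorField (Ψ x)) (L u) < 0 := hu.2
  have h1tl : 𝓢.metric.IsTimelike (L w) := by
    have := htl' 1 ⟨zero_le_one, le_rfl⟩
    simpa using this
  refine ⟨h1tl.isCausal, ?_⟩
  show 𝓢.metric.val (Ψ x) (𝓢.timeOrientation.vectorField (Ψ x)) (L w) < 0
  by_contra hcon
  push Not at hcon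
  set f0 := 𝓢.metric.val (Ψ x) (𝓢.timeOrientation.vectorField (Ψ x)) (L u) with hf0
  set f1 := 𝓢.metric.val (Ψ x) (𝓢.timeOrientation.vectorField (Ψ x)) (L w) with hf1
  have hd : 0 < f1 - f0 := by linarith
  set θs : ℝ := -f0 / (f1 - f0) with hθs
  have hθs0 : 0 ≤ θs := div_nonneg (by linarith) hd.le
  have hθs1 : θs ≤ 1 := by rw [hθs, div_le_one hd]; linarith
  refine hne θs ⟨hθs0, hθs1⟩ ?_
  rw [hlin θs, hθs]
  field_simp
  ring

/-- Components of a ray point `(τ, s v)`. [folklore] -/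
private theorem ray_apply (τ s : ℝ) (v : E3) :
    E4.ofTimeSpace τ (s • v) 1 = s * v 0 ∧ E4.ofTimeSpace τ (s • v) 2 = s * v 1 ∧
      E4.ofTimeSpace τ (s • v) 3 = s * v 2 := by
  refine ⟨?_, ?_, ?_⟩
  · have h := E4.ofTimeSpace_apply_succ τ (s • v) 0
    simpa using h
  · have h := E4.ofTimeSpace_apply_succ τ (s • v) 1
    simpa using h
  · have h := E4.ofTimeSpace_apply_succ τ (s • v) 2
    simpa using h

/-- **Ray monotonicity holds** (from the landed solid-ellipsoid description of the sublevel sets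
`kerrSublevel_radius_lt_iff`: if `r(τ, s'v) < r(τ, sv) =: c` with `0 ≤ s ≤ s'` then `c > 0`, the point
`(τ, sv)` lies ON the ellipsoid `q_c = c²(c² + a²)` while `(τ, s'v)` lies strictly inside it, although
`q_c(s'v) = s'² q_c(v) ≥ s² q_c(v) = q_c(sv)`). [folklore] -/
theorem radiusRayMonotone : RadiusRayMonotone := by
  intro a τ v s s' hs hss'
  by_contra hlt
  push Not at hlt
  obtain ⟨hy1, hy2, hy3⟩ := ray_apply τ s v
  obtain ⟨hy'1, hy'2, hy'3⟩ := ray_apply τ s' v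
  set y := E4.ofTimeSpace τ (s • v) with hy
  set y' := E4.ofTimeSpace τ (s' • v) with hy'
  set c := Kerr.radius a y with hcdef
  have hc : 0 < c := (Kerr.radius_nonneg a y').trans_lt hlt
  have h1 := (Summit.FinalStateConjecture.FinalStateConjecture.Theorems.kerrSublevel_radius_lt_iff hc y').1 hlt
  have h2 : ¬ (Kerr.radius a y < c) := lt_irrefl _
  rw [Summit.FinalStateConjecture.FinalStateConjecture.Theorems.kerrSublevel_radius_lt_iff hc y] at h2
  push Not at h2
  rw [hy1, hy2, hy3] at h2
  rw [hy'1, hy'2, hy'3] at h1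
  have hQ : 0 ≤ c ^ 2 * (v 0 ^ 2 + v 1 ^ 2) + (c ^ 2 + a ^ 2) * v 2 ^ 2 := by positivity
  have hs2 : s ^ 2 ≤ s' ^ 2 := pow_le_pow_left₀ hs hss' 2
  have key : c ^ 2 * ((s * v 0) ^ 2 + (s * v 1) ^ 2) + (c ^ 2 + a ^ 2) * (s * v 2) ^ 2 ≤
      c ^ 2 * ((s' * v 0) ^ 2 + (s' * v 1) ^ 2) + (c ^ 2 + a ^ 2) * (s' * v 2) ^ 2 := by
    have := mul_le_mul_of_nonneg_right hs2 hQ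
    nlinarith [this]
  linarith

/-- `truncDeviationCk` is monotone in the derivative order `k` (`supCkENorm_mono_right`). [folklore] -/
theorem truncDeviationCk_mono_k (𝓢 : Spacetime.{u} 4) (B : ModelBackground) (Ψ : B.domain → 𝓢.carrier)
    {k k' : ℕ} (h : k ≤ k') (R τ : ℝ) :
    𝓢.truncDeviationCk B Ψ k R τ ≤ 𝓢.truncDeviationCk B Ψ k' R τ := by
  unfold Spacetime.truncDeviationCk
  exact supCkENorm_mono_right _ h _

/-- **The transfer is certified: C⁺ ⇒ the crux.**  `SlabOrientationFromAnchor` implies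
`Theses.StarvedNecks.FutureOrientedOfSeamed`, using from the 17 clauses only Hc (a) (`0 < M` is the
structure's, sub-extremality and `100 M ≤ R₀`, orthochronous `Λ` for clause (i)), Hc (d) (clause (iii)),
Sm (1) (`R₀ + 4 ≤ Rᵢ`, so the anchor sphere `{r = R₀}` is certified) and Sm (5) (the anchor), plus the
STRUCTURE's fixed-radius `C²` (hence `C⁰`) convergence. -/
theorem futureOrientedOfSeamed_of_slabOrientationFromAnchor (h : SlabOrientationFromAnchor) :
    Summit.FinalStateConjecture.FinalStateConjecture.Theses.StarvedNecks.FutureOrientedOfSeamed := by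
  dsimp only [Summit.FinalStateConjecture.FinalStateConjecture.Theses.StarvedNecks.FutureOrientedOfSeamed]
  intro X _ _ _ _ D hD 𝒟 h𝒟 O d R R₀ hO hc hs
  obtain ⟨ha, -, -, hd⟩ := hc
  obtain ⟨h1, -, -, -, h5, -⟩ := hs
  refine ⟨fun i ↦ (ha i).2.2, fun i ρ ↦ ?_, ?_⟩
  · -- clause (ii): the chart-local transfer, anchored on the sphere `r = R₀` by Sm (5)
    have hconv : ∀ ρ' : ℝ, Tendsto (fun τ ↦ 𝒟.toSpacetime.truncDeviationCk
        (boostedKerrBackground (d.motion i).1 (d.motion i).2 (d.mass i) (d.spin i)) (d.chart i) 0 ρ' τ)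
        atTop (𝓝 0) := fun ρ' ↦
      tendsto_of_tendsto_of_tendsto_of_le_of_le tendsto_const_nhds (d.tendsto_truncDeviationCk i ρ')
        (fun _ ↦ zero_le) (fun τ ↦ truncDeviationCk_mono_k _ _ _ (Nat.zero_le 2) _ _)
    have hanchor : ∀ x : (boostedKerrBackground (d.motion i).1 (d.motion i).2 (d.mass i) (d.spin i)).domain,
        d.τ₀ ≤ (boostedKerrBackground (d.motion i).1 (d.motion i).2 (d.mass i) (d.spin i)).time x.1 →
        (boostedKerrBackground (d.motion i).1 (d.motion i).2 (d.mass i) (d.spin i)).radius x.1 = R₀ →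
        𝒟.toSpacetime.timeOrientation.IsFutureDirected
          (mfderiv 𝓘(ℝ, E4) (𝓡 4) (d.chart i) x (((d.motion i).1 : E4 ≃L[ℝ] E4) (E4.basisVector 0))) := by
      intro x hT hr
      refine h5 i x (Or.inl hT) (ge_of_eq hr) ?_
      have h14 := ((h1 i).2.2 ((d.background i).time x.1)).1
      show (d.background i).radius x.1 ≤ R i ((d.background i).time x.1)
      have hr' : (d.background i).radius x.1 = R₀ := hr
      rw [hr']
      linarith
    exact h 𝒟.toSpacetime (d.mass i) (d.spin i) (d.motion i).1 (d.motion i).2 (d.chart i) R₀ d.τ₀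
      (d.mass_pos i) (ha i).1 (ha i).2.1 (d.isLateChart i).contMDiff hconv hanchor ρ
  · -- clause (iii): Hc (d) on every flat slab `τ > τ₀`
    filter_upwards [eventually_gt_atTop d.τ₀] with τ hτ
    intro x hx
    refine hd x ?_
    have hx0 : (x : E4) 0 = τ := hx
    rw [hx0]
    exact hτ

end Summit.FinalStateConjecture.FinalStateConjecture.Cruxes.FutureOrientedOfSeamed.ClockDualityRays

end
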